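import Summits.CriticalPhenomena.Ising3DConformalLimit.Theses.SubPtolemyInterlacing
import Literature.Probability.LatticeModels.GKSInequalities
import Literature.Probability.LatticeModels.PlusFreeComparison
import Literature.Probability.LatticeModels.GibbsStatesProofs
import HarnessLib

/-!
# `SubPtolemyInterlacing.InterlacingSubcritical`: reduction to finite boxes
(helper for item stmt-CriticalPhenomena-15705)

THEOREM-ONLY file (no definitions, no named facts). The support item `InterlacingSubcritical` of
route `SubPtolemyInterlacing` (sub-problem `Ising3DConformalLimit`) is the sub-Ptolemy /
interlacing inequality

`⟨σ_{p0}σ_{pa}σ_{p(a+b)}σ_{p(a+b+c)}⟩ · ⟨σ_{p0}σ_{p(a+b)}⟩⟨σ_{pa}σ_{p(a+b+c)}⟩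
   ≤ ⟨σ_{p0}σ_{pa}⟩⟨σ_{p(a+b)}σ_{p(a+b+c)}⟩ · ⟨σ_{p0}σ_{p(a+b+c)}⟩⟨σ_{pa}σ_{p(a+b)}⟩`,
`p k = k • e₁`, for the plus state `⟨·⟩⁺_{β,0}` of `ℤ³`, `0 ≤ β < β_c(3)`, `a, b, c ≥ 1`.

The route files it as the "finite-volume-friendly form" of the crux `Interlacing`; this file makes
that literal: the infinite-volume statement follows from the same product inequality for the
finite-volume Gibbs states in the boxes `Λ(L) = {-L,…,L}³`, assumed only **eventually in `L`**
(for each `β, a, b, c`), either with `+` boundary condition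
(`interlacingSubcritical_of_plus_boxes`) or with free boundary condition
(`interlacingSubcritical_of_free_boxes`) — the latter being the natural setting of the
random-current reformulation `p₁₃(1+q) ≤ p₁₂p₁₄` (no ghost vertex).

Inputs (all theorems of the tree): existence of the plus / free states on spin products along
boxes (`hasBoxLimit_isingCorr_plus_holds`, `hasBoxLimit_isingCorr_free_holds`, Friedli–Velenik
2017 Thm. 3.17 / Exercise 3.16), `m*(β) = 0` for `0 ≤ β < β_c`
(`spontaneousMagnetization_eq_zero_of_lt_criticalBeta_holds`) and `⟨σ_A⟩^∅_{β,0} = ⟨σ_A⟩⁺_{β,0}`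
when `m*(β) = 0` (`freeCorr_eq_plusCorr_of_spontaneousMagnetization_eq_zero`, Lebowitz–Martin-Löf);
limits of products and `le_of_tendsto_of_tendsto`.
-/

namespace Summit.CriticalPhenomena.Ising3DConformalLimit.Theorems

open Filter Topology
open Literature.Probability.LatticeModels
open Summit.CriticalPhenomena.Ising3DConformalLimit.Theses

/-- **Plus boxes suffice.** If for every `0 ≤ β < β_c(3)` and all `a, b, c ≥ 1` the interlacing
inequality holds for the `+`-boundary-condition Gibbs states `⟨·⟩⁺_{Λ(L);β,0}` of all sufficiently
large boxes `Λ(L) = {-L,…,L}³`, then `InterlacingSubcritical` holds: each of the seven correlations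
converges along boxes to its plus-state value (`hasBoxLimit_isingCorr_plus_holds`, Friedli–Velenik
2017, Thm. 3.17), and a non-strict inequality between products passes to the limit. [cite: FriedliVelenik2017, Thm. 3.17, p. 106] -/
theorem interlacingSubcritical_of_plus_boxes
    (h : ∀ β : ℝ, 0 ≤ β → β < criticalBeta 3 → ∀ a b c : ℕ, 1 ≤ a → 1 ≤ b → 1 ≤ c →
      let p : ℕ → Site 3 := fun k => (k : ℤ) • (Pi.single 0 1 : Site 3)
      ∀ᶠ L : ℕ in atTop,
        isingCorr (zdGraph 3) (box 3 L) β 0 .plus {p 0, p a, p (a + b), p (a + b + c)} *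
            (isingCorr (zdGraph 3) (box 3 L) β 0 .plus {p 0, p (a + b)} *
              isingCorr (zdGraph 3) (box 3 L) β 0 .plus {p a, p (a + b + c)}) ≤
          isingCorr (zdGraph 3) (box 3 L) β 0 .plus {p 0, p a} *
              isingCorr (zdGraph 3) (box 3 L) β 0 .plus {p (a + b), p (a + b + c)} *
            (isingCorr (zdGraph 3) (box 3 L) β 0 .plus {p 0, p (a + b + c)} *
              isingCorr (zdGraph 3) (box 3 L) β 0 .plus {p a, p (a + b)})) :
    SubPtolemyInterlacing.InterlacingSubcritical := by
  unfold SubPtolemyInterlacing.InterlacingSubcritical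
  intro β hβ hβc a b c ha hb hc p
  have T : ∀ A : Finset (Site 3),
      Tendsto (fun L : ℕ => isingCorr (zdGraph 3) (box 3 L) β 0 .plus A) atTop
        (𝓝 (plusCorr 3 β 0 A)) :=
    fun A => hasBoxLimit_isingCorr_plus_holds (d := 3) hβ le_rfl A
  exact le_of_tendsto_of_tendsto ((T _).mul ((T _).mul (T _)))
    (((T _).mul (T _)).mul ((T _).mul (T _))) (h β hβ hβc a b c ha hb hc)

/-- **Free boxes suffice.** If for every `0 ≤ β < β_c(3)` and all `a, b, c ≥ 1` the interlacing
inequality holds for the free-boundary-condition Gibbs states `⟨·⟩^∅_{Λ(L);β,0}` of all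
sufficiently large boxes, then `InterlacingSubcritical` holds: the free box states converge to the
free state (`hasBoxLimit_isingCorr_free_holds`, Friedli–Velenik 2017, Exercise 3.16), which
coincides with the plus state on spin products because `m*(β) = 0` for `β < β_c`
(`spontaneousMagnetization_eq_zero_of_lt_criticalBeta_holds`,
`freeCorr_eq_plusCorr_of_spontaneousMagnetization_eq_zero`). [cite: FriedliVelenik2017, Exercise 3.16, p. 115, and Def. 3.32, p. 120] -/
theorem interlacingSubcritical_of_free_boxes
    (h : ∀ β : ℝ, 0 ≤ β → β < criticalBeta 3 → ∀ a b c : ℕ, 1 ≤ a → 1 ≤ b → 1 ≤ c →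
      let p : ℕ → Site 3 := fun k => (k : ℤ) • (Pi.single 0 1 : Site 3)
      ∀ᶠ L : ℕ in atTop,
        isingCorr (zdGraph 3) (box 3 L) β 0 .free {p 0, p a, p (a + b), p (a + b + c)} *
            (isingCorr (zdGraph 3) (box 3 L) β 0 .free {p 0, p (a + b)} *
              isingCorr (zdGraph 3) (box 3 L) β 0 .free {p a, p (a + b + c)}) ≤
          isingCorr (zdGraph 3) (box 3 L) β 0 .free {p 0, p a} *
              isingCorr (zdGraph 3) (box 3 L) β 0 .free {p (a + b), p (a + b + c)} *
            (isingCorr (zdGraph 3) (box 3 L) β 0 .free {p 0, p (a + b + c)} *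
              isingCorr (zdGraph 3) (box 3 L) β 0 .free {p a, p (a + b)})) :
    SubPtolemyInterlacing.InterlacingSubcritical := by
  unfold SubPtolemyInterlacing.InterlacingSubcritical
  intro β hβ hβc a b c ha hb hc p
  have hm : spontaneousMagnetization 3 β = 0 :=
    spontaneousMagnetization_eq_zero_of_lt_criticalBeta_holds (d := 3) hβ hβc
  have T : ∀ A : Finset (Site 3),
      Tendsto (fun L : ℕ => isingCorr (zdGraph 3) (box 3 L) β 0 .free A) atTop
        (𝓝 (plusCorr 3 β 0 A)) := by
    intro A
    rw [← freeCorr_eq_plusCorr_of_spontaneousMagnetization_eq_zero hβ hm A]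
    exact hasBoxLimit_isingCorr_free_holds (d := 3) hβ le_rfl A
  exact le_of_tendsto_of_tendsto ((T _).mul ((T _).mul (T _)))
    (((T _).mul (T _)).mul ((T _).mul (T _))) (h β hβ hβc a b c ha hb hc)

end Summit.CriticalPhenomena.Ising3DConformalLimit.Theorems
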